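import Mathlib

/-!
# Crux `BinomialElusive.BinomialCandidate` (stmt-ValiantsHypothesis-7392), line `registered` —
# stub `stub_crossCap`, piece 1: the Weierstrass eliminant

Abstract elimination step of the cross-cap argument.  Let `A := ℂ⟦W_1, …, W_m⟧`
(`MvPowerSeries (Fin m) ℂ`), `𝔪 = (W_1, …, W_m)` its augmentation ideal, and let
`F₀, F₁ ∈ A⟦X⟧` be two power series in one further variable `X` such that, writing
`F_a = Σ_j f_{a,j} X^j` (`f_{a,j} ∈ A`),

* `f_{0,0}, f_{0,1}, f_{1,0}, f_{1,1} ∈ 𝔪` (zero constant coefficients),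
* `c₀ := f_{0,2}(0) ≠ 0`.

Then `F₀` is a Weierstrass divisor of order `2` at `𝔪` (`A` is `𝔪`-adically complete, Mathlib),
and dividing `F₁ = F₀ q + (r₀ + r₁ X)` and `X F₁ = F₀ q' + (r₀' + r₁' X)` we put
`D := r₀ r₁' - r₁ r₀' ∈ A` (the determinant of multiplication by `F₁` on the free rank-two
`A`-module `A⟦X⟧/(F₀)`).  `crossCap_eliminant` records:

1. `D ∈ (F₀, F₁)`: explicitly `C D = U F₀ + V F₁` with `U = r₁ q' - r₁' q`, `V = r₁' - r₁ X`;
2. `D ∈ 𝔪` (`D(0) = 0`);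
3. for a variable `W_i`, the coefficient of `W_i²` in `D` is `(λ_i(f_{1,0}) - (c₁/c₀) λ_i(f_{0,0}))²`
   where `λ_i` is the coefficient of `W_i` and `c₁ := f_{1,2}(0)`; in particular it is nonzero as
   soon as `c₀ λ_i(f_{1,0}) ≠ c₁ λ_i(f_{0,0})`.

The proof of 2–3 compares the coefficients of `X⁰, …, X³` in the two division identities
(`q(0) ≡ c₁/c₀`, `r₀ ≡ f_{1,0} - (c₁/c₀) f_{0,0}`, `r₁ ∈ 𝔪`, `r₀' ∈ 𝔪²`-ish, `r₁' ≡ r₀` to first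
order).  Mathlib only (`PowerSeries.IsWeierstrassDivisorAt.isWeierstrassDivisionAt_div_mod`).
-/

-- layout Summits/ValiantsHypothesis/ValiantsHypothesis forces the duplicated namespace component
set_option linter.dupNamespace false

noncomputable section

namespace Summit.ValiantsHypothesis.ValiantsHypothesis.Theorems.BinomialCandidateStubs

open scoped BigOperators

namespace CrossCap

variable {m : ℕ}

/-! ## The augmentation ideal of `ℂ⟦W_1, …, W_m⟧` -/

-- The augmentation ideal `(W_1, …, W_m)` of `A = ℂ⟦W_1, …, W_m⟧` is written out as
-- `Ideal.span (Set.range MvPowerSeries.X)` throughout; `A` is adically complete for it (Mathlib).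

/-- Power series supported on monomials avoiding all variables outside `s`, with zero constant
coefficient, lie in the augmentation ideal (induction on `s`, peeling one variable at a time with
`MvPowerSeries.X_dvd_iff`). -/
theorem mem_augIdeal_of_support (s : Finset (Fin m)) :
    ∀ f : MvPowerSeries (Fin m) ℂ, MvPowerSeries.constantCoeff f = 0 →
      (∀ d, MvPowerSeries.coeff d f ≠ 0 → d.support ⊆ s) → f ∈ (Ideal.span (Set.range MvPowerSeries.X) : Ideal (MvPowerSeries (Fin m) ℂ)) := by
  classical
  induction s using Finset.induction_on with
  | empty =>
    intro f hf hs
    have : f = 0 := by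
      ext d
      by_cases hd : d = 0
      · subst hd
        simpa using hf
      · rw [MvPowerSeries.coeff_zero]
        by_contra h
        apply hd
        ext i
        have hi : i ∉ d.support := fun hi => by simpa using hs d h hi
        simpa using hi
    rw [this]
    exact zero_mem _
  | insert a s ha ih =>
    intro f hf hs
    let f' : MvPowerSeries (Fin m) ℂ := fun d => if d a = 0 then MvPowerSeries.coeff d f else 0
    have hcoeff : ∀ d, MvPowerSeries.coeff d f' = if d a = 0 then MvPowerSeries.coeff d f else 0 :=
      fun d => rfl
    have h1 : f' ∈ (Ideal.span (Set.range MvPowerSeries.X) : Ideal (MvPowerSeries (Fin m) ℂ)) := by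
      refine ih f' ?_ ?_
      · rw [← MvPowerSeries.coeff_zero_eq_constantCoeff_apply, hcoeff]
        simp [hf]
      · intro d hd i hi
        rw [hcoeff] at hd
        split_ifs at hd with hda
        · rcases Finset.mem_insert.mp (hs d hd hi) with rfl | h
          · exact absurd hda (Finsupp.mem_support_iff.mp hi)
          · exact h
        · exact absurd rfl hd
    have h2 : MvPowerSeries.X a ∣ f - f' := by
      rw [MvPowerSeries.X_dvd_iff]
      intro d hd
      rw [map_sub, hcoeff, if_pos hd, sub_self]
    have h3 : f - f' ∈ (Ideal.span (Set.range MvPowerSeries.X) : Ideal (MvPowerSeries (Fin m) ℂ)) := by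
      obtain ⟨g, hg⟩ := h2
      rw [hg]
      exact Ideal.mul_mem_right _ _ (Ideal.subset_span ⟨a, rfl⟩)
    have : f = f' + (f - f') := by ring
    rw [this]
    exact add_mem h1 h3

/-- Membership in the augmentation ideal is vanishing of the constant coefficient. -/
theorem mem_augIdeal_iff {f : MvPowerSeries (Fin m) ℂ} :
    f ∈ (Ideal.span (Set.range MvPowerSeries.X) : Ideal (MvPowerSeries (Fin m) ℂ)) ↔
      MvPowerSeries.constantCoeff f = 0 := by
  constructor
  · intro hf
    have hle : (Ideal.span (Set.range MvPowerSeries.X) : Ideal (MvPowerSeries (Fin m) ℂ)) ≤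
        RingHom.ker (MvPowerSeries.constantCoeff (σ := Fin m) (R := ℂ)) := by
      refine Ideal.span_le.mpr ?_
      rintro _ ⟨i, rfl⟩
      simp
    exact hle hf
  · intro hf
    exact mem_augIdeal_of_support Finset.univ f hf fun d _ => Finset.subset_univ _

/-! ## Low coefficients of products -/

section CoeffMul

variable {A : Type*} [CommSemiring A]

/-- `X⁰`-coefficient of a product. -/
theorem coeff_zero_mul' (φ ψ : PowerSeries A) :
    PowerSeries.coeff 0 (φ * ψ) = PowerSeries.coeff 0 φ * PowerSeries.coeff 0 ψ := by
  simp [PowerSeries.coeff_mul]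

/-- `X¹`-coefficient of a product. -/
theorem coeff_one_mul' (φ ψ : PowerSeries A) :
    PowerSeries.coeff 1 (φ * ψ) =
      PowerSeries.coeff 0 φ * PowerSeries.coeff 1 ψ + PowerSeries.coeff 1 φ * PowerSeries.coeff 0 ψ := by
  rw [PowerSeries.coeff_mul, Finset.Nat.sum_antidiagonal_eq_sum_range_succ_mk]
  simp [Finset.sum_range_succ]

/-- `X²`-coefficient of a product. -/
theorem coeff_two_mul' (φ ψ : PowerSeries A) :
    PowerSeries.coeff 2 (φ * ψ) =
      PowerSeries.coeff 0 φ * PowerSeries.coeff 2 ψ + PowerSeries.coeff 1 φ * PowerSeries.coeff 1 ψ +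
        PowerSeries.coeff 2 φ * PowerSeries.coeff 0 ψ := by
  rw [PowerSeries.coeff_mul, Finset.Nat.sum_antidiagonal_eq_sum_range_succ_mk]
  simp [Finset.sum_range_succ]

/-- `X³`-coefficient of a product. -/
theorem coeff_three_mul' (φ ψ : PowerSeries A) :
    PowerSeries.coeff 3 (φ * ψ) =
      PowerSeries.coeff 0 φ * PowerSeries.coeff 3 ψ + PowerSeries.coeff 1 φ * PowerSeries.coeff 2 ψ +
        PowerSeries.coeff 2 φ * PowerSeries.coeff 1 ψ + PowerSeries.coeff 3 φ * PowerSeries.coeff 0 ψ := by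
  rw [PowerSeries.coeff_mul, Finset.Nat.sum_antidiagonal_eq_sum_range_succ_mk]
  simp [Finset.sum_range_succ]

/-- `X¹`-coefficient of `X φ`. -/
theorem coeff_one_X_mul' (φ : PowerSeries A) :
    PowerSeries.coeff 1 (PowerSeries.X * φ) = PowerSeries.coeff 0 φ :=
  PowerSeries.coeff_succ_X_mul 0 φ

/-- `X²`-coefficient of `X φ`. -/
theorem coeff_two_X_mul' (φ : PowerSeries A) :
    PowerSeries.coeff 2 (PowerSeries.X * φ) = PowerSeries.coeff 1 φ :=
  PowerSeries.coeff_succ_X_mul 1 φ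

/-- `X³`-coefficient of `X φ`. -/
theorem coeff_three_X_mul' (φ : PowerSeries A) :
    PowerSeries.coeff 3 (PowerSeries.X * φ) = PowerSeries.coeff 2 φ :=
  PowerSeries.coeff_succ_X_mul 2 φ

end CoeffMul

/-- Product rule for the coefficient of a single variable `W_i`. -/
theorem coeff_single_one_mul (i : Fin m) (f g : MvPowerSeries (Fin m) ℂ) :
    MvPowerSeries.coeff (Finsupp.single i 1) (f * g) =
      MvPowerSeries.coeff (Finsupp.single i 1) f * MvPowerSeries.constantCoeff g +
        MvPowerSeries.constantCoeff f * MvPowerSeries.coeff (Finsupp.single i 1) g := by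
  classical
  rw [MvPowerSeries.coeff_mul, Finsupp.antidiagonal_single, Finset.sum_map,
    Finset.Nat.sum_antidiagonal_eq_sum_range_succ_mk]
  simp [Finset.sum_range_succ]
  ring

/-- The coefficient of `W_i²` in a product of two elements of the augmentation ideal. -/
theorem coeff_single_two_mul (i : Fin m) (f g : MvPowerSeries (Fin m) ℂ)
    (hf : MvPowerSeries.constantCoeff f = 0) (hg : MvPowerSeries.constantCoeff g = 0) :
    MvPowerSeries.coeff (Finsupp.single i 2) (f * g) =
      MvPowerSeries.coeff (Finsupp.single i 1) f * MvPowerSeries.coeff (Finsupp.single i 1) g := by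
  classical
  rw [MvPowerSeries.coeff_mul, Finsupp.antidiagonal_single, Finset.sum_map]
  simp [Finset.Nat.antidiagonal_succ, hf, hg]

/-! ## `F₀` is a Weierstrass divisor of order two -/

section Weierstrass

variable (F₀ : PowerSeries (MvPowerSeries (Fin m) ℂ))
  (h00 : MvPowerSeries.constantCoeff (PowerSeries.coeff 0 F₀) = 0)
  (h01 : MvPowerSeries.constantCoeff (PowerSeries.coeff 1 F₀) = 0)
  (h02 : MvPowerSeries.constantCoeff (PowerSeries.coeff 2 F₀) ≠ 0)
include h00 h01 h02

/-- The image of `F₀` in `(A/𝔪)⟦X⟧ = ℂ⟦X⟧` has order exactly `2`. -/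
theorem order_map_eq_two :
    (F₀.map (Ideal.Quotient.mk (Ideal.span (Set.range MvPowerSeries.X) : Ideal (MvPowerSeries (Fin m) ℂ)))).order = 2 := by
  refine PowerSeries.order_eq_nat.mpr ⟨?_, ?_⟩
  · rw [PowerSeries.coeff_map, Ne, Ideal.Quotient.eq_zero_iff_mem, mem_augIdeal_iff]
    exact h02
  · intro i hi
    interval_cases i
    · rw [PowerSeries.coeff_map, Ideal.Quotient.eq_zero_iff_mem, mem_augIdeal_iff]
      exact h00
    · rw [PowerSeries.coeff_map, Ideal.Quotient.eq_zero_iff_mem, mem_augIdeal_iff]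
      exact h01

/-- Numeric form of `order_map_eq_two`. -/
theorem order_toNat_eq_two :
    (F₀.map (Ideal.Quotient.mk (Ideal.span (Set.range MvPowerSeries.X) : Ideal (MvPowerSeries (Fin m) ℂ)))).order.toNat = 2 := by
  rw [order_map_eq_two F₀ h00 h01 h02]
  rfl

/-- `F₀` is a Weierstrass divisor (of order `2`) at the augmentation ideal. -/
theorem isWeierstrassDivisorAt :
    F₀.IsWeierstrassDivisorAt (Ideal.span (Set.range MvPowerSeries.X) : Ideal (MvPowerSeries (Fin m) ℂ)) := by
  unfold PowerSeries.IsWeierstrassDivisorAt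
  rw [order_toNat_eq_two F₀ h00 h01 h02, MvPowerSeries.isUnit_iff_constantCoeff]
  exact isUnit_iff_ne_zero.mpr h02

end Weierstrass

/-- A polynomial of degree `< 2`, as a power series, is `C r₀ + C r₁ X`. -/
theorem coe_eq_of_degree_lt_two {A : Type*} [CommRing A] (r : Polynomial A)
    (h : r.degree < (2 : ℕ)) :
    (r : PowerSeries A) = PowerSeries.C (r.coeff 0) + PowerSeries.C (r.coeff 1) * PowerSeries.X := by
  ext n
  rcases n with _ | _ | n
  · simp [Polynomial.coeff_coe]
  · simp [Polynomial.coeff_coe]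
  · have : r.coeff (n + 2) = 0 :=
      Polynomial.coeff_eq_zero_of_degree_lt (lt_of_lt_of_le h (by exact_mod_cast (by omega)))
    simp [Polynomial.coeff_coe, this]

end CrossCap

open CrossCap in
/-- **The Weierstrass eliminant** (piece 1 of the stub `stub_crossCap`).  For `F₀, F₁ ∈ A⟦X⟧`,
`A = ℂ⟦W_1, …, W_m⟧`, with `f_{0,0}, f_{0,1}, f_{1,0}, f_{1,1} ∈ 𝔪` and `f_{0,2}(0) ≠ 0`
(`f_{a,j}` the `X^j`-coefficient of `F_a`), and a variable `W_i` with
`f_{0,2}(0) · λ_i(f_{1,0}) ≠ f_{1,2}(0) · λ_i(f_{0,0})` (`λ_i` = coefficient of `W_i`), there is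
`D ∈ A` in the ideal `(F₀, F₁)` of `A⟦X⟧` with `D(0) = 0` and nonzero `W_i²`-coefficient. -/
theorem crossCap_eliminant :
    ∀ (m : ℕ) (F₀ F₁ : PowerSeries (MvPowerSeries (Fin m) ℂ)) (i : Fin m),
      MvPowerSeries.constantCoeff (PowerSeries.coeff 0 F₀) = 0 →
      MvPowerSeries.constantCoeff (PowerSeries.coeff 1 F₀) = 0 →
      MvPowerSeries.constantCoeff (PowerSeries.coeff 2 F₀) ≠ 0 →
      MvPowerSeries.constantCoeff (PowerSeries.coeff 0 F₁) = 0 →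
      MvPowerSeries.constantCoeff (PowerSeries.coeff 1 F₁) = 0 →
      MvPowerSeries.constantCoeff (PowerSeries.coeff 2 F₀) *
          MvPowerSeries.coeff (Finsupp.single i 1) (PowerSeries.coeff 0 F₁) ≠
        MvPowerSeries.constantCoeff (PowerSeries.coeff 2 F₁) *
          MvPowerSeries.coeff (Finsupp.single i 1) (PowerSeries.coeff 0 F₀) →
      ∃ (D : MvPowerSeries (Fin m) ℂ) (U V : PowerSeries (MvPowerSeries (Fin m) ℂ)),
        PowerSeries.C D = U * F₀ + V * F₁ ∧ MvPowerSeries.constantCoeff D = 0 ∧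
          MvPowerSeries.coeff (Finsupp.single i 2) D ≠ 0 := by
  intro m F₀ F₁ i h00 h01 h02 h10 h11 hL
  have H := isWeierstrassDivisorAt F₀ h00 h01 h02
  have hn := order_toNat_eq_two F₀ h00 h01 h02
  obtain ⟨hdeg, hE1⟩ := H.isWeierstrassDivisionAt_div_mod F₁
  obtain ⟨hdeg', hE2⟩ := H.isWeierstrassDivisionAt_div_mod (PowerSeries.X * F₁)
  rw [hn] at hdeg hdeg'
  generalize H.div F₁ = q at hE1
  generalize H.mod F₁ = r at hE1 hdeg
  generalize H.div (PowerSeries.X * F₁) = q' at hE2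
  generalize H.mod (PowerSeries.X * F₁) = r' at hE2 hdeg'
  have hr := coe_eq_of_degree_lt_two r hdeg
  have hr' := coe_eq_of_degree_lt_two r' hdeg'
  have hr2 : r.coeff 2 = 0 := Polynomial.coeff_eq_zero_of_degree_lt hdeg
  have hr'2 : r'.coeff 2 = 0 := Polynomial.coeff_eq_zero_of_degree_lt hdeg'
  have hr'3 : r'.coeff 3 = 0 :=
    Polynomial.coeff_eq_zero_of_degree_lt (hdeg'.trans (by exact_mod_cast (by norm_num)))
  -- the seven coefficient identities
  have E1_0 := congrArg (PowerSeries.coeff 0) hE1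
  have E1_1 := congrArg (PowerSeries.coeff 1) hE1
  have E1_2 := congrArg (PowerSeries.coeff 2) hE1
  have E2_0 := congrArg (PowerSeries.coeff 0) hE2
  have E2_1 := congrArg (PowerSeries.coeff 1) hE2
  have E2_2 := congrArg (PowerSeries.coeff 2) hE2
  have E2_3 := congrArg (PowerSeries.coeff 3) hE2
  simp only [PowerSeries.coeff_zero_X_mul, coeff_one_X_mul', coeff_two_X_mul',
    coeff_three_X_mul'] at E2_0 E2_1 E2_2 E2_3
  simp only [map_add, coeff_zero_mul', coeff_one_mul', coeff_two_mul', coeff_three_mul',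
    Polynomial.coeff_coe, hr2, hr'2, hr'3, add_zero] at E1_0 E1_1 E1_2 E2_0 E2_1 E2_2 E2_3
  revert hr hr' E1_0 E1_1 E1_2 E2_0 E2_1 E2_2 E2_3 h00 h01 h02 h10 h11 hL
  generalize PowerSeries.coeff 0 F₀ = f00
  generalize PowerSeries.coeff 1 F₀ = f01
  generalize PowerSeries.coeff 2 F₀ = f02
  generalize PowerSeries.coeff 3 F₀ = f03
  generalize PowerSeries.coeff 0 F₁ = f10
  generalize PowerSeries.coeff 1 F₁ = f11
  generalize PowerSeries.coeff 2 F₁ = f12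
  generalize PowerSeries.coeff 0 q = q0
  generalize PowerSeries.coeff 1 q = q1
  generalize PowerSeries.coeff 2 q = q2
  generalize PowerSeries.coeff 0 q' = q'0
  generalize PowerSeries.coeff 1 q' = q'1
  generalize PowerSeries.coeff 2 q' = q'2
  generalize PowerSeries.coeff 3 q' = q'3
  generalize r.coeff 0 = r0
  generalize r.coeff 1 = r1
  generalize r'.coeff 0 = r'0
  generalize r'.coeff 1 = r'1
  intro h00 h01 h02 h10 h11 hL hr hr' E1_0 E1_1 E1_2 E2_0 E2_1 E2_2 E2_3
  -- constant coefficients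
  have c_r0 : MvPowerSeries.constantCoeff r0 = 0 := by
    have := congrArg MvPowerSeries.constantCoeff E1_0
    simp only [map_add, map_mul, h00, h10, zero_mul, zero_add] at this
    exact this.symm
  have c_r1 : MvPowerSeries.constantCoeff r1 = 0 := by
    have := congrArg MvPowerSeries.constantCoeff E1_1
    simp only [map_add, map_mul, h00, h01, h11, zero_mul, zero_add] at this
    exact this.symm
  have c_q0 : MvPowerSeries.constantCoeff f12 =
      MvPowerSeries.constantCoeff f02 * MvPowerSeries.constantCoeff q0 := by
    have := congrArg MvPowerSeries.constantCoeff E1_2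
    simp only [map_add, map_mul, h00, h01, zero_mul, zero_add] at this
    exact this
  have c_r'0 : MvPowerSeries.constantCoeff r'0 = 0 := by
    have := congrArg MvPowerSeries.constantCoeff E2_0
    simp only [map_zero, map_add, map_mul, h00, zero_mul, zero_add] at this
    exact this.symm
  have c_q'0 : MvPowerSeries.constantCoeff q'0 = 0 := by
    have := congrArg MvPowerSeries.constantCoeff E2_2
    simp only [map_add, map_mul, h00, h01, h11, zero_mul, zero_add] at this
    exact (mul_eq_zero.mp this.symm).resolve_left h02
  have c_r'1 : MvPowerSeries.constantCoeff r'1 = 0 := by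
    have := congrArg MvPowerSeries.constantCoeff E2_1
    simp only [map_add, map_mul, h00, h01, h10, zero_mul, zero_add] at this
    exact this.symm
  have c_q'1 : MvPowerSeries.constantCoeff f12 =
      MvPowerSeries.constantCoeff f02 * MvPowerSeries.constantCoeff q'1 := by
    have := congrArg MvPowerSeries.constantCoeff E2_3
    simp only [map_add, map_mul, h00, h01, c_q'0, zero_mul, mul_zero, zero_add, add_zero] at this
    exact this
  -- coefficients of `W_i`
  have l_r0 : MvPowerSeries.coeff (Finsupp.single i 1) r0 =
      MvPowerSeries.coeff (Finsupp.single i 1) f10 -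
        MvPowerSeries.coeff (Finsupp.single i 1) f00 * MvPowerSeries.constantCoeff q0 := by
    have := congrArg (MvPowerSeries.coeff (Finsupp.single i 1)) E1_0
    simp only [map_add, coeff_single_one_mul, h00, zero_mul, add_zero] at this
    linear_combination -this
  have l_r'1 : MvPowerSeries.coeff (Finsupp.single i 1) r'1 =
      MvPowerSeries.coeff (Finsupp.single i 1) f10 -
        MvPowerSeries.coeff (Finsupp.single i 1) f00 * MvPowerSeries.constantCoeff q'1 := by
    have := congrArg (MvPowerSeries.coeff (Finsupp.single i 1)) E2_1
    simp only [map_add, coeff_single_one_mul, h00, h01, c_q'0, zero_mul, mul_zero, add_zero]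
      at this
    linear_combination -this
  have l_r'0 : MvPowerSeries.coeff (Finsupp.single i 1) r'0 = 0 := by
    have := congrArg (MvPowerSeries.coeff (Finsupp.single i 1)) E2_0
    simp only [map_zero, map_add, coeff_single_one_mul, h00, c_q'0, zero_mul, mul_zero,
      zero_add] at this
    exact this.symm
  -- the eliminant
  refine ⟨r0 * r'1 - r1 * r'0, PowerSeries.C r1 * q' - PowerSeries.C r'1 * q,
    PowerSeries.C r'1 - PowerSeries.C r1 * PowerSeries.X, ?_, ?_, ?_⟩
  · have e1 : PowerSeries.C r0 + PowerSeries.C r1 * PowerSeries.X = F₁ - F₀ * q := by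
      rw [← hr, hE1]; ring
    have e2 : PowerSeries.C r'0 + PowerSeries.C r'1 * PowerSeries.X =
        PowerSeries.X * F₁ - F₀ * q' := by
      rw [← hr', hE2]; ring
    rw [map_sub, map_mul, map_mul]
    linear_combination (PowerSeries.C r'1) * e1 - (PowerSeries.C r1) * e2
  · rw [map_sub, map_mul, map_mul, c_r0, c_r1, zero_mul, zero_mul, sub_zero]
  · rw [map_sub, coeff_single_two_mul i _ _ c_r0 c_r'1, coeff_single_two_mul i _ _ c_r1 c_r'0,
      l_r'0, mul_zero, sub_zero]
    have k0 : MvPowerSeries.constantCoeff f02 * MvPowerSeries.coeff (Finsupp.single i 1) r0 =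
        MvPowerSeries.constantCoeff f02 * MvPowerSeries.coeff (Finsupp.single i 1) f10 -
          MvPowerSeries.constantCoeff f12 * MvPowerSeries.coeff (Finsupp.single i 1) f00 := by
      rw [l_r0, c_q0]; ring
    have k1 : MvPowerSeries.constantCoeff f02 * MvPowerSeries.coeff (Finsupp.single i 1) r'1 =
        MvPowerSeries.constantCoeff f02 * MvPowerSeries.coeff (Finsupp.single i 1) f10 -
          MvPowerSeries.constantCoeff f12 * MvPowerSeries.coeff (Finsupp.single i 1) f00 := by
      rw [l_r'1, c_q'1]; ring
    have hne := mul_ne_zero (k0 ▸ sub_ne_zero.mpr hL) (k1 ▸ sub_ne_zero.mpr hL)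
    intro h
    apply hne
    linear_combination (MvPowerSeries.constantCoeff f02) ^ 2 * h

end Summit.ValiantsHypothesis.ValiantsHypothesis.Theorems.BinomialCandidateStubs

end
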